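import Summits.PneNP.PneNP.Theorems.SzkEntropyPeaThreeNotInP
import Literature.Computability.Complexity.PromiseProofs

/-!
# Sketch — crux-ideate stmt-PneNP-10776 (`SzkEntropy.PeaThreeNotInP`), ideator 1, round 1

First lemmas of the two idea cards `two-to-one-rigidity` and `tensor-orbit-two-query`,
stated over existing declarations (`PEA`, `PED`, `PolyMapF2`, `PromiseP`,
`PromiseProblem.PolyTimeReducible`, `PeaThreeNotInP`).  Everything tagged `sorry` is a stub of
the corresponding line, not a claim; the untagged theorems are proved here.
-/

set_option linter.dupNamespace false

namespace Summit.PneNP.PneNP.Cruxes.PeaThreeNotInP.SketchIdeator1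

open Literature.Computability.Complexity _root_.Computability Finset
open Summit.PneNP.PneNP.Theses.SzkEntropy (PeaThreeNotInP)
open Summit.PneNP.PneNP.Theorems (szkEntropy_peaThreeNotInP_iff)

/-! ## Card `two-to-one-rigidity`: injective versus two-to-one cubic maps -/

/-- Every fibre of the sparse map `P : F₂ⁿ → F₂^m` (over all of `F₂ⁿ`) has exactly `c` points. -/
def ConstFibre {n : ℕ} (P : PolyMapF2 n) (c : ℕ) : Prop :=
  ∀ x : Fin n → ZMod 2, (univ.filter fun x' : Fin n → ZMod 2 => P.eval x' = P.eval x).card = c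

/-- **INJ-vs-2TO1₃**: on instances `(n, p, k)` of `PEA` with `k + 1 = n` and `deg p ≤ 3`,
YES iff `p` is injective on `F₂ⁿ` (all fibres singletons), NO iff `p` is exactly two-to-one.
A sub-promise problem of `PEA 3` (`injTwoToOne_yes_subset`, `injTwoToOne_no_subset`). -/
noncomputable def InjTwoToOne : PromiseProblem :=
  PromiseProblem.ofEncoding PEAInst.encoding
    {I | PolyMapF2.DegLE 3 I.2.1 ∧ I.2.2 + 1 = I.1 ∧ ConstFibre I.2.1 1}
    {I | PolyMapF2.DegLE 3 I.2.1 ∧ I.2.2 + 1 = I.1 ∧ ConstFibre I.2.1 2}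

/-- A map on `F₂ⁿ` all of whose fibres have `c` points has output entropy `n - log₂ c`. -/
theorem entropy_eq_of_constFibre {n c : ℕ} (P : PolyMapF2 n) (hc : 0 < c) (h : ConstFibre P c) :
    P.entropy = n - Real.logb 2 c := by
  unfold PolyMapF2.entropy Literature.InformationTheory.Entropy.mapEntropy
  have hcard : ((univ : Finset (Fin n → ZMod 2)).card : ℝ) = (2 : ℝ) ^ n := by simp
  have hfib : ∀ x : Fin n → ZMod 2,
      ((Literature.InformationTheory.Entropy.fiber univ P.eval (P.eval x)).card : ℝ) = c := by
    intro x
    unfold Literature.InformationTheory.Entropy.fiber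
    exact_mod_cast h x
  simp_rw [hfib, hcard]
  rw [Finset.sum_const, nsmul_eq_mul, hcard]
  have hpos : (2 : ℝ) ^ n ≠ 0 := by positivity
  have hc' : (c : ℝ) ≠ 0 := by exact_mod_cast hc.ne'
  have h2n : Real.logb 2 ((2 : ℝ) ^ n) = n := by
    rw [Real.logb_pow, Real.logb_self_eq_one one_lt_two, mul_one]
  rw [mul_div_cancel_left₀ _ hpos, Real.logb_div hpos hc', h2n]

/-- An injective map on `F₂ⁿ` has output entropy `n`. -/
theorem entropy_eq_of_constFibre_one {n : ℕ} (P : PolyMapF2 n) (h : ConstFibre P 1) :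
    P.entropy = n := by
  rw [entropy_eq_of_constFibre P one_pos h]; simp

/-- An exactly two-to-one map on `F₂ⁿ` has output entropy `n - 1`. -/
theorem entropy_eq_of_constFibre_two {n : ℕ} (P : PolyMapF2 n) (h : ConstFibre P 2) :
    P.entropy = n - 1 := by
  rw [entropy_eq_of_constFibre P two_pos h, Nat.cast_ofNat, Real.logb_self_eq_one one_lt_two]

/-- YES-instances of INJ-vs-2TO1₃ are YES-instances of `PEA 3`. -/
theorem injTwoToOne_yes_subset : ∀ ⦃w⦄, w ∈ InjTwoToOne.yes → w ∈ (PEA 3).yes := by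
  intro w hw
  obtain ⟨I, hI, rfl⟩ : ∃ I, I ∈ _ ∧ PEAInst.encoding.encode I = w := hw
  obtain ⟨hdeg, hk, hfib⟩ :
      PolyMapF2.DegLE 3 I.2.1 ∧ I.2.2 + 1 = I.1 ∧ ConstFibre I.2.1 1 := hI
  refine (encode_mem_PEA_yes_iff 3 I).2 ⟨hdeg, ?_⟩
  rw [entropy_eq_of_constFibre_one I.2.1 hfib]
  exact le_of_eq (by exact_mod_cast hk)

/-- NO-instances of INJ-vs-2TO1₃ are NO-instances of `PEA 3`. -/
theorem injTwoToOne_no_subset : ∀ ⦃w⦄, w ∈ InjTwoToOne.no → w ∈ (PEA 3).no := by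
  intro w hw
  obtain ⟨I, hI, rfl⟩ : ∃ I, I ∈ _ ∧ PEAInst.encoding.encode I = w := hw
  obtain ⟨hdeg, hk, hfib⟩ :
      PolyMapF2.DegLE 3 I.2.1 ∧ I.2.2 + 1 = I.1 ∧ ConstFibre I.2.1 2 := hI
  refine (encode_mem_PEA_no_iff 3 I).2 ⟨hdeg, ?_⟩
  rw [entropy_eq_of_constFibre_two I.2.1 hfib]
  have : (I.1 : ℝ) = I.2.2 + 1 := by exact_mod_cast hk.symm
  linarith

/-- **First lemma of the line `two-to-one-rigidity` (proved): hardness of the rigid sub-promise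
gives thesis X.**  If no polynomial-time algorithm tells injective cubic maps from exactly
two-to-one cubic maps, then `PEA_3 ∉ PromiseP`. -/
theorem peaThreeNotInP_of_injTwoToOne (h : InjTwoToOne ∉ PromiseP) : PeaThreeNotInP := by
  rw [szkEntropy_peaThreeNotInP_iff]
  intro hP
  obtain ⟨L, hL, hy, hn⟩ := hP
  exact h ⟨L, hL, fun w hw => hy (injTwoToOne_yes_subset hw), fun w hw => hn (injTwoToOne_no_subset hw)⟩

/-! ## Card `tensor-orbit-two-query`: tensor isomorphism embeds in `PEA 3` / `PED 3` -/

/-- `3`-tensors `n × n × n` over `F₂`. -/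
abbrev Tensor3 (n : ℕ) : Type := Fin n → Fin n → Fin n → ZMod 2

/-- The action of a matrix triple on a `3`-tensor:
`((A,B,C)·T)_{ijl} = ∑_{i'j'l'} A_{ii'} B_{jj'} C_{ll'} T_{i'j'l'}` — for FIXED `T` a polynomial
map of degree `3` in the `3n²` matrix entries (the lever of the card). -/
def act {n : ℕ} (A B C : Matrix (Fin n) (Fin n) (ZMod 2)) (T : Tensor3 n) : Tensor3 n :=
  fun i j l => ∑ i', ∑ j', ∑ l', A i i' * B j j' * C l l' * T i' j' l'

/-- Isomorphism of `3`-tensors under `GL_n(F₂)³`. -/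
def TensorIsomorphic {n : ℕ} (T₀ T₁ : Tensor3 n) : Prop :=
  ∃ A B C : Matrix (Fin n) (Fin n) (ZMod 2), IsUnit A ∧ IsUnit B ∧ IsUnit C ∧ act A B C T₀ = T₁

/-- Instances of TENSOR ISOMORPHISM: `n` and two tensors given by their supports. -/
abbrev TIInst : Type := Σ n : ℕ, List ((Fin n × Fin n) × Fin n) × List ((Fin n × Fin n) × Fin n)

/-- Boolean code of an index triple. -/
def tripleEncoding (n : ℕ) : Encoding ((Fin n × Fin n) × Fin n) Bool :=
  ((encodingFinBool n).pairBool (encodingFinBool n)).pairBool (encodingFinBool n)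

/-- Boolean code of TI instances. -/
def TIInst.encoding : Encoding TIInst Bool :=
  Encoding.sigmaBool fun n => (tripleEncoding n).listBool.pairBool (tripleEncoding n).listBool

/-- The tensor with the given support. -/
def ofSupport {n : ℕ} (S : List ((Fin n × Fin n) × Fin n)) : Tensor3 n :=
  fun i j l => if ((i, j), l) ∈ S then 1 else 0

/-- **TENSOR ISOMORPHISM over `F₂`** as a promise problem (a language: NO = non-isomorphic pairs). -/
noncomputable def TensorIso : PromiseProblem :=
  PromiseProblem.ofEncoding TIInst.encoding
    {I | TensorIsomorphic (ofSupport I.2.1) (ofSupport I.2.2)}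
    {I | ¬ TensorIsomorphic (ofSupport I.2.1) (ofSupport I.2.2)}

section OrbitMap

variable {n : ℕ}

/-- Variable index of the entry `A i i'` (first block of `n²` variables). -/
def varA (i i' : Fin n) : Fin (n * n + n * n + n * n) :=
  Fin.castAdd (n * n) (Fin.castAdd (n * n) (finProdFinEquiv (i, i')))

/-- Variable index of the entry `B j j'` (second block). -/
def varB (j j' : Fin n) : Fin (n * n + n * n + n * n) :=
  Fin.castAdd (n * n) (Fin.natAdd (n * n) (finProdFinEquiv (j, j')))

/-- Variable index of the entry `C l l'` (third block). -/
def varC (l l' : Fin n) : Fin (n * n + n * n + n * n) :=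
  Fin.natAdd (n * n + n * n) (finProdFinEquiv (l, l'))

/-- **The orbit map of `T` as a SPARSE CUBIC MAP** `F₂^{3n²} → F₂^{n³}`: output `(i,j,l)` is the
polynomial `∑_{(i',j',l') ∈ supp T} A_{ii'} B_{jj'} C_{ll'}`. -/
def orbitMap (T : Tensor3 n) : PolyMapF2 (n * n + n * n + n * n) :=
  (List.finRange n).flatMap fun i => (List.finRange n).flatMap fun j => (List.finRange n).map fun l =>
    (List.finRange n).flatMap fun i' => (List.finRange n).flatMap fun j' =>
      (List.finRange n).filterMap fun l' =>
        if T i' j' l' = 1 then some [varA i i', varB j j', varC l l'] else none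

/-- The orbit map is syntactically cubic. (stub, routine) -/
theorem degLE_orbitMap (T : Tensor3 n) : (orbitMap T).DegLE 3 := by
  sorry

/-- The orbit map evaluates to the acted tensor: reading the matrix entries off the valuation,
`(orbitMap T).eval v` lists the entries of `act A B C T` in lexicographic order. (stub, routine) -/
theorem eval_orbitMap (T : Tensor3 n) (v : Fin (n * n + n * n + n * n) → ZMod 2) :
    (orbitMap T).eval v =
      ((List.finRange n).flatMap fun i => (List.finRange n).flatMap fun j =>
        (List.finRange n).map fun l =>
          act (Matrix.of fun i i' => v (varA i i')) (Matrix.of fun j j' => v (varB j j'))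
            (Matrix.of fun l l' => v (varC l l')) T i j l) := by
  sorry

/-- S1 (stub, routine): acting twice is acting by the products — the input bijection
`(A,B,C) ↦ (A h₁, B h₂, C h₃)` behind the EXACT smear invariance `law((A,B,C)·T₁) = law((A,B,C)·T₀)`
for `T₁ = (h₁,h₂,h₃)·T₀` when `A, B, C` are uniform over ALL matrices. -/
theorem act_act (A B C h₁ h₂ h₃ : Matrix (Fin n) (Fin n) (ZMod 2)) (T : Tensor3 n) :
    act A B C (act h₁ h₂ h₃ T) = act (A * h₁) (B * h₂) (C * h₃) T := by
  sorry

/-- S3 (stub, short): at least a quarter of all `n × n` matrices over `F₂` are invertible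
(`|GL_n(F₂)| = ∏_{i<n} (2ⁿ - 2ⁱ) ≥ 2^{n²}/4` from `1 - x ≥ 4^{-x}` on `[0, 1/2]`), so the event
"all three smearing matrices invertible" has probability `≥ 1/64`. -/
theorem card_matrix_le_four_mul_card_units (n : ℕ) :
    Fintype.card (Matrix (Fin n) (Fin n) (ZMod 2)) ≤
      4 * Fintype.card (Matrix (Fin n) (Fin n) (ZMod 2))ˣ := by
  sorry

end OrbitMap

/-- **FIRST LEMMA of the line `tensor-orbit-two-query` (stub S, the load-bearing construction):
TENSOR ISOMORPHISM Karp-reduces to `PED_{F₂,3}` WITHOUT any group sampler** (after the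
poly-time passage to concise cores by flattening ranks).
`F(b, A, B, C) := (b, (A,B,C)·T_b)` with `A, B, C` ranging over ALL of `M_n(F₂)` (uniform bits),
`F'` := `F` without the output `b`; both are re-encoded in degree `3` by `encodeBDDs` applied to
the width-2 parity BDDs of the selector coordinates (entropy shift known syntactically).
Isomorphic ⇒ `H(F) = H(F') + 1` exactly (`act_act`); non-isomorphic ⇒ `H(F) - H(F') ≤ 63/64`
(on concise tensors invertibility of `(A,B,C)` is a function of the output, orbits are disjoint,
`card_matrix_le_four_mul_card_units`). The instance map is
`(T₀, T₁) ↦ (p, q) := (F̂^{×128}, F̂'^{×128} × id_{127})`: iso ⇒ `H(p) = H(q) + 1`,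
non-iso ⇒ `H(p) + 1 ≤ H(q)`. -/
theorem tensorIso_polyTimeReducible_PED : TensorIso.PolyTimeReducible (PED 3) := by
  sorry

/-- **Bridge (stub, in print DGRV §3 p. 6): `PEA_3 ∈ prP ⇒ PED_3 ∈ prP`** — the nonadaptive
reduction asking `PEA(p, j)`, `PEA(q, j)` for all `j ≤ m` after a `3`-fold product; the answer
vectors are monotone up to one off-promise slot, so `#yes`-answers approximate `H` within `1`. -/
theorem PED_three_mem_PromiseP_of_PEA (h : PEA 3 ∈ PromiseP) : PED 3 ∈ PromiseP := by
  sorry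

/-- **Composition (proved from the two stubs): hardness of TENSOR ISOMORPHISM gives thesis X.** -/
theorem peaThreeNotInP_of_tensorIso_hard (hTI : TensorIso ∉ PromiseP) : PeaThreeNotInP := by
  rw [szkEntropy_peaThreeNotInP_iff]
  intro hPEA
  exact hTI (PromiseProblem.mem_PromiseP_of_polyTimeReducible_holds tensorIso_polyTimeReducible_PED
    (PED_three_mem_PromiseP_of_PEA hPEA))

end Summit.PneNP.PneNP.Cruxes.PeaThreeNotInP.SketchIdeator1
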